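import Summits.BirchSwinnertonDyer.BirchSwinnertonDyer.Theorems.UniversalToricDescentTwinSplitIMCAtThreeOfValueFrame
import Summits.BirchSwinnertonDyer.BirchSwinnertonDyer.Theorems.UniversalToricDescentTwinSplitIMCAtThreeSupsetGoodSS
import Summits.BirchSwinnertonDyer.BirchSwinnertonDyer.Theorems.EisensteinPrimesBSDpOnCellCLogSymmetry
import Summits.BirchSwinnertonDyer.Rank1Residual.Partition.AnticyclotomicControlJSWEmbAt
import Summits.BirchSwinnertonDyer.Rank1Residual.Partition.AnticyclotomicControlPublished
import Summits.BirchSwinnertonDyer.Rank1Residual.O5.HeegnerLogTransportThreeKrizLiGlue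
import Summits.BirchSwinnertonDyer.Rank1Residual.X11b.CharIdealTrivialCharacter
import Literature.NumberTheory.EllipticCurves.JetchevSkinnerWan2017.AnticyclotomicControl
import Literature.NumberTheory.EllipticCurves.CastellaGrossiLeeSkinner2022.IMC2DivisibilityAndBDPValueFrame
import HarnessLib

/-!
# Route `UniversalToricDescent`, child `TwinSplitIMCAtThreeGoodSS` (item stmt-BirchSwinnertonDyer-20695 of
# route rev 17; bucket C = 603 of the 2 023 twin classes): crux #3 at a good-SUPERSINGULAR twin of analytic
# rank one over `K` from NAMED inputs only — the CÇSS18 Howard-direction claim (PRE), JSW 2017 Thm. 3.3.1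
# (control, refereed, typed at `p = 3`), CGLS 2022 Thm. 5.1.3 (BDP value at `𝟙`, refereed) — and ONE
# scalar identity: the `3`-part of the Gross–Zagier–BSD index formula for the twin over `K`

Seat `bsd-wall-utd-p2` g2 (D-0131 (3) MIDDLE tier; memo `HOME/bsd-wall/bsd-wall-utd-p2/SUPSET-AT3-v4.md`).
This is the VALUE-FRAME route (`…TwinSplitIMCAtThreeOfValueFrame.lean`, p547868) made concrete: the
"rational Wan frame" of `…OfThreeFrames` — which at `p = 3` under the classical Heegner hypothesis is in NO
print, not even a preprint — is REPLACED by value data at the trivial character that IS in refereed print,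
plus one number: `2·ord₃[E′(K) : ℤ·P] = ord₃ #Ш(E′/K)[3^∞] + ord₃ ∏_w c_w(E′/K) + 2·ord₃ c` for the
Heegner point `P = P_K` of the twin and the Manin constant `c` of its parametrisation (`hIdx`). By
Gross–Zagier + Kolyvagin exactness this number is the `3`-part of BSD for `E′/K`, i.e. `BSD₃(E′) ∧
BSD₃(E′^{d_K})` — the W-ALL row-C3 / corner-X7 residuals for the twin pair — so on bucket C the child crux
20695 AT ITS RANK-ONE INSTANCES (`r_an(E′/K) = 1`: Heegner point of `E′` over `K` non-torsion) carries NO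
research content beyond (a) the PRE claim and (b) residuals the wall already lists elsewhere. CAVEAT (read the
kernel, p533077 ll. 135–150): `ToricKernelAtThree` applies crux #3 to the twin `W′` at the Heegner field `K`
chosen for `E` (Friedberg–Hoffstein for `N(E)`, `2N(E′)`), with NO condition on `r_an(E′/K)` (odd by the
Heegner hypothesis, not necessarily `1`); the rank-one instances are reached only by a kernel/closes re-keyed
to choose `(E′, K)` JOINTLY (census D1-JOINT-HEEGNER-v1: 674/745 bucket-A classes, QC2: 559/603 bucket-C
classes admit such a pair in range). Kernel-checked, sorry-free; CONDITIONAL on the named inputs `hC` (OPEN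
claim, unrefereed), `h331`, `h513` (refereed facts) and on the scalar hypothesis `hIdx`; `hc : c ≠ 0` (Manin
constant) is a hypothesis (dischargeable by `Dt′.maninConstant_ne_zero_holds`).

* §1 `norm_constantCoeff_eq_of_valueShape` (any prime `p`): the value shape of CGLS 5.1.3,
  `L(0) = u·c⁻²·(1 − a_p p⁻¹ + p⁻¹)²·x²`, and a generator `f ∈ ℤ_p⟦T⟧` with
  `ord_p f(0) = 2·(ord_p(1 − a_p + p) − 1 + ord_p x − ord_p c)` give `‖L(0)‖ = ‖f(0)‖` in `ℂ_p`.
* §2 `valueFrame_of_goodSS_of_thm331_of_thm513` (`p = 3`): for `W′` GOOD SUPERSINGULAR at `3` with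
  `ρ̄₃` onto over `ℚ`, `K` Heegner for `N′ = N(W′)` with `3 = 𝔭𝔭′` split and `d_K` odd, `rank E′(K) = 1`,
  `Ш(E′/K)[3^∞]` finite, `P ∈ E′(K)` the Heegner point of `(Dt′, H)` of infinite order, and `hIdx`:
  `Ch_Λ(X_ac(W′_K) strict at 𝔭′)·R₀⟦T⟧ = (F)` with `F(0) ≠ 0` and a frame `L` of `f_{W′}` at `(ι′, 𝔭)` with
  `‖L(0)‖ = ‖F(0)‖`. Control is applied at the STRICT prime `𝔭′` along THE embedding `embAt K 3 𝔭′`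
  (checklist T1), the value formula at the frame's prime `𝔭` along `embAt K 3 𝔭`; the two logarithms have
  the same `ord₃` (`LogSymmetry.padicLogOrd_eq_of_finrank_eq_two`: rank one, `σP = ±P + torsion`). At
  `a_3 ∈ {0, ±3}` the Euler-type factor `(1 − a_3 + 3)` is a `3`-adic UNIT (`4 − a_3 ∈ {1, 4, 7}`), so no
  anomalous term survives.
* §3 `twinSplit_instance_of_goodSS_of_ccss_of_thm331_of_thm513` — with the Howard frame of the CÇSS18
  claim (`exists_howardFrame_isTorsion_of_goodSS_of_ccss`, p546254): conjuncts (i) ∧ (ii) of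
  `TwinSplitIMCAtThree` VERBATIM at `(W′, N′, K, Dt′, κ, γ, 𝔭, 𝔭′, ι′)`.

PARTITION currency: bucket C (603): child 20695 at rank-one instances ⟸ {PRE claim p545192; JSW17 3.3.1;
CGLS22 5.1.3; `hIdx`}. Beyond-print BSD theorem: NO (`hIdx` is BSD₃ of the twin pair in index form; the
claim is unrefereed). `--supports stmt-BirchSwinnertonDyer-20695`.

References: [CastellaCiperianiSkinnerSprung2018] Thm. 5.7, Lemma 5.5 (arXiv:1804.10993v2 §5.1);
[JetchevSkinnerWan2017] Thm. 3.3.1, (3.5.d), §7.4.1 (Camb. J. Math. 5); [CastellaGrossiLeeSkinner2022]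
Thm. 5.1.3 (Invent. Math. 227); [GrossZagier1986] Thm. I.6.3 and [GrossLMS1991] Thm. 1.3 (the index form
of BSD over `K`, the content of `hIdx`); [Castella2018] Thm. 3.1 (frame), Thm. 2.3 (control shape).
-/

noncomputable section

open scoped Classical Topology

set_option linter.dupNamespace false
set_option autoImplicit false

namespace Summit.BirchSwinnertonDyer.BirchSwinnertonDyer.Theorems.UniversalToricDescentTwinSplit

open Filter PowerSeries WeierstrassCurve NumberField IsDedekindDomain Field
  Literature.NumberTheory.EllipticCurves
  Literature.NumberTheory.EllipticCurves.ModularForms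
  Literature.NumberTheory.EllipticCurves.Rank1Residual
  Literature.NumberTheory.EllipticCurves.JetchevSkinnerWan2017
  Literature.NumberTheory.EllipticCurves.CastellaGrossiLeeSkinner2022
  Literature.NumberTheory.GaloisRepresentations
  Summit.BirchSwinnertonDyer.Rank1Residual
  Summit.BirchSwinnertonDyer.Rank1Residual.X11b
  Summit.BirchSwinnertonDyer.Rank1Residual.X11b.Halves
  Summit.BirchSwinnertonDyer.Rank1Residual.X11b.CongruenceLimit
  Summit.BirchSwinnertonDyer.BirchSwinnertonDyer.Theorems.SchneiderFree

/-! ## §1 The value shape and a generator with the matching valuation give `‖L(0)‖ = ‖f(0)‖` -/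

section AnyPrime

variable {p : ℕ} [hp : Fact p.Prime]

/-- **`‖L(0)‖ = ‖f(0)‖` from the CGLS value shape and the control valuation.** `f ∈ ℤ_p⟦T⟧` with
`f(0) ≠ 0` and `ord_p f(0) = 2·(ord_p(1 − a + p) − 1 + ord_p x − ord_p c)`; `L ∈ R₀⟦T⟧` with
`L(0) = u·(c⁻²·(1 − a p⁻¹ + p⁻¹)²·x²)`, `u ∈ R₀ˣ`, `c ≠ 0`, `1 − a + p ≠ 0`, `x ≠ 0`: then
`‖L(0)‖ = ‖f(0)‖` in `ℂ_p` (`f(0)` read along `toUnr : ℤ_p → R₀`). Pure `p`-adic bookkeeping: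
`1 − a p⁻¹ + p⁻¹ = (1 − a + p)·p⁻¹`. [folklore] -/
theorem norm_constantCoeff_eq_of_valueShape {f : IwasawaAlgebra p} (hf0 : PowerSeries.constantCoeff f ≠ 0)
    {L : UnrSeries p} (u : (unrIntegers p)ˣ) {c a : ℤ} (hc : c ≠ 0) (ha : 1 - a + p ≠ 0) {x : ℚ_[p]}
    (hx : x ≠ 0)
    (hL : L.HasValueAt 0 (((u : unrIntegers p) : ℂ_[p]) *
      algebraMap ℚ_[p] ℂ_[p] (((c : ℚ_[p])⁻¹) ^ 2 *
        (1 - (a : ℚ_[p]) * (p : ℚ_[p])⁻¹ + (p : ℚ_[p])⁻¹) ^ 2 * x ^ 2)))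
    (hval : ((PowerSeries.constantCoeff f).valuation : ℤ) =
      2 * ((padicValInt p (1 - a + p) : ℤ) - 1 + x.valuation - padicValInt p c)) :
    ‖((PowerSeries.constantCoeff L : unrIntegers p) : ℂ_[p])‖ =
      ‖((PowerSeries.constantCoeff (PowerSeries.map (toUnr p) f) : unrIntegers p) : ℂ_[p])‖ := by
  have hp0 : (p : ℚ_[p]) ≠ 0 := Nat.cast_ne_zero.mpr hp.out.ne_zero
  have hc0 : (c : ℚ_[p]) ≠ 0 := Int.cast_ne_zero.mpr hc
  set y : ℚ_[p] := 1 - (a : ℚ_[p]) * (p : ℚ_[p])⁻¹ + (p : ℚ_[p])⁻¹ with hy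
  have hyeq : y = ((1 - a + p : ℤ) : ℚ_[p]) * (p : ℚ_[p])⁻¹ := by
    rw [hy]; push_cast; field_simp; ring
  have ha0 : ((1 - a + p : ℤ) : ℚ_[p]) ≠ 0 := Int.cast_ne_zero.mpr ha
  have hy0 : y ≠ 0 := by rw [hyeq]; exact mul_ne_zero ha0 (inv_ne_zero hp0)
  set q : ℚ_[p] := ((c : ℚ_[p])⁻¹) ^ 2 * y ^ 2 * x ^ 2 with hq
  have hq0 : q ≠ 0 := mul_ne_zero (mul_ne_zero (pow_ne_zero _ (inv_ne_zero hc0)) (pow_ne_zero _ hy0))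
    (pow_ne_zero _ hx)
  -- valuations
  have hyval : y.valuation = (padicValInt p (1 - a + p) : ℤ) - 1 := by
    rw [hyeq, Padic.valuation_mul ha0 (inv_ne_zero hp0), Padic.valuation_intCast, Padic.valuation_inv,
      Padic.valuation_p]
    ring
  have hqval : q.valuation = 2 * ((padicValInt p (1 - a + p) : ℤ) - 1 + x.valuation - padicValInt p c) := by
    rw [hq, Padic.valuation_mul (mul_ne_zero (pow_ne_zero _ (inv_ne_zero hc0)) (pow_ne_zero _ hy0))
      (pow_ne_zero _ hx), Padic.valuation_mul (pow_ne_zero _ (inv_ne_zero hc0)) (pow_ne_zero _ hy0),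
      Padic.valuation_pow, Padic.valuation_pow, Padic.valuation_pow, Padic.valuation_inv,
      Padic.valuation_intCast, hyval]
    push_cast
    ring
  -- `L(0)` and `f(0)` as elements of `ℂ_p`
  have hL0 : ((u : unrIntegers p) : ℂ_[p]) * algebraMap ℚ_[p] ℂ_[p] q =
      ((PowerSeries.constantCoeff L : unrIntegers p) : ℂ_[p]) :=
    UnrSeries.eq_constantCoeff_of_hasValueAt_zero hL
  rw [← hL0, norm_mul, norm_coe_units_unrIntegers, one_mul, norm_algebraMap', constantCoeff_map_apply,
    coe_toUnr, norm_algebraMap', Padic.norm_eq_zpow_neg_valuation hq0,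
    Padic.norm_eq_zpow_neg_valuation (fun h ↦ hf0 (PadicInt.coe_eq_zero.mp h) :
      ((PowerSeries.constantCoeff f : ℤ_[p]) : ℚ_[p]) ≠ 0), PadicInt.valuation_coe, hqval, hval]

end AnyPrime

/-! ## §2 `p = 3`: the value frame of a good-supersingular twin from JSW 3.3.1 and CGLS 5.1.3 -/

section Three

variable (W' : WeierstrassCurve ℚ) [W'.IsElliptic] [W'.IsGloballyMinimal] (N' : ℕ) [NeZero N']
  (K : Type) [Field K] [NumberField K] (Dt' : ModularParametrizationData W' N')
  (κ : ZpExtension K 3) (γ : absoluteGaloisGroup K)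
  (𝔭 𝔭' : HeightOneSpectrum (𝓞 K)) (ι' : PadicAlgCl 3 ≃+* ℂ)

/-- `3` splits in `K` gives the Heegner hypothesis "for `N = 3`". [folklore] -/
theorem satisfiesHeegnerHypothesis_three_of_ncard {K : Type} [Field K] [NumberField K]
    (hspl : ((Ideal.span {((3 : ℕ) : ℤ)}).primesOver (𝓞 K)).ncard = 2) :
    SatisfiesHeegnerHypothesis 3 K := by
  intro q hq hq3
  have : q = 3 := (Nat.prime_dvd_prime_iff_eq hq Nat.prime_three).mp hq3
  subst this
  exact hspl

/-- At a good-supersingular `3` the Euler-type factor is a unit: `3 ∣ a_3 ⟹ 1 − a_3 + 3 ≠ 0` (indeed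
`ord₃(4 − a_3) = 0`). [folklore] -/
theorem one_sub_add_three_ne_zero_of_dvd {a : ℤ} (ha : (3 : ℤ) ∣ a) : 1 - a + (3 : ℕ) ≠ 0 := by
  obtain ⟨k, rfl⟩ := ha
  push_cast
  omega

/-- `ord₃(1 − a_3 + 3) = 0` when `3 ∣ a_3`. [folklore] -/
theorem padicValInt_one_sub_add_three_of_dvd {a : ℤ} (ha : (3 : ℤ) ∣ a) :
    padicValInt 3 (1 - a + (3 : ℕ)) = 0 := by
  obtain ⟨k, rfl⟩ := ha
  rw [padicValInt.eq_zero_iff]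
  push_cast
  omega

/-- **The VALUE FRAME of a good-supersingular twin of analytic rank one, from refereed print + the index
identity.** Data: `W′` globally minimal, GOOD SUPERSINGULAR at `3`, `ρ̄_{W′,3}` onto over `ℚ`, conductor
`N′`; `Dt′` a parametrisation datum (newform `Dt′.f`, Manin constant `Dt′.c ≠ 0`); `K` imaginary quadratic
Heegner for `N′` with `d_K` odd; `κ` anticyclotomic with topological generator `γ`; `𝔭 ∋ 3` of degree one,
`𝔭′ ∋ 3` (ANY prime above `3`: the value identity at `𝟙` is orientation-blind, checklist T1 (b)); `ι′`
inducing `𝔭`; `H` a Heegner datum, `P ∈ E′(K)` its Heegner point (read along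
`w.embedding`) of infinite order; `rank_ℤ E′(K) = 1`, `Ш(E′/K)[3^∞]` finite (GZK for the twin pair); and
`hIdx : 2·ord₃[E′(K):ℤP] = ord₃ #Ш(E′/K)[3^∞] + ord₃ ∏_w c_w(E′/K) + 2·ord₃ c`. Conclusion:
`Ch_Λ(X_ac(W′_K) strict at 𝔭′)·R₀⟦T⟧ = (F)` with `F(0) ≠ 0`, and a frame `(Ω_K ≠ 0, Ω_p ≠ 0, L)` of
`f_{W′}` at `(ι′, 𝔭)` with `‖L(0)‖ = ‖F(0)‖`. CONDITIONAL on `h331` (JSW 2017 Thm. 3.3.1) and `h513`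
(CGLS 2022 Thm. 5.1.3). [cite: JetchevSkinnerWan2017, Thm. 3.3.1 with §3.5 (3.5.d) (arXiv:1512.06894 pp. 11, 16)]
[cite: CastellaGrossiLeeSkinner2022, Thm. 5.1.3 (Invent. Math. 227)] -/
theorem valueFrame_of_goodSS_of_thm331_of_thm513
    (h331 : thm331_anticyclotomicControl) (h513 : thm513_exists_isBDPLFunction_valueAtOne_disc)
    (hss : GoodSS W' 3) (hsurj : W'.HasSurjectiveModNGaloisRep 3) (hN' : W'.conductorNorm ℤ = N')
    (hc : Dt'.c ≠ 0)
    (hK : IsImaginaryQuadratic K) (hH : SatisfiesHeegnerHypothesis N' K)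
    (hodd : Odd (NumberField.discr K)) (hκ : κ.IsAnticyclotomic) [hγ : Fact (κ.IsTopGenerator γ)]
    (h𝔭 : ((3 : ℕ) : 𝓞 K) ∈ 𝔭.asIdeal)
    (he : 𝔭.asIdeal.ramificationIdx (𝓞 ℚ) = 1) (hf : 𝔭.asIdeal.inertiaDeg (𝓞 ℚ) = 1)
    (h𝔭' : ((3 : ℕ) : 𝓞 K) ∈ 𝔭'.asIdeal)
    (hι' : BranchInducesPrime 3 ι' 𝔭)
    (H : HeegnerDatum N' (NumberField.discr K)) (w : InfinitePlace K)
    (P : (W'.baseChange K).toAffine.Point)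
    (hPH : WeierstrassCurve.Affine.Point.map w.embedding.toRatAlgHom P = heegnerPointComplex Dt' H)
    (hP0 : ¬ IsOfFinAddOrder P)
    (hrk : (W'.baseChange K).mordellWeilRank = 1)
    (hfin : Finite (AddCommGroup.primaryComponent (W'.baseChange K).sha 3))
    (hIdx : 2 * (padicValNat 3 (AddSubgroup.zmultiples P).index : ℤ) =
      (padicValNat 3 (Nat.card (AddCommGroup.primaryComponent (W'.baseChange K).sha 3)) : ℤ) +
        (padicValNat 3 (W'.baseChange K).tamagawaProduct : ℤ) + 2 * padicValInt 3 Dt'.c) :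
    ∃ F : UnrSeries 3,
      (AcSelmer.XAc.charIdeal (W'.baseChange K) 3 κ 𝔭' ∅ γ).map (PowerSeries.map (toUnr 3)) =
        Ideal.span {F} ∧
      PowerSeries.constantCoeff F ≠ 0 ∧
      ∃ (ΩK : ℂ) (Ωp : ℂ_[3]) (L : UnrSeries 3), ΩK ≠ 0 ∧ Ωp ≠ 0 ∧
        IsBDPLFunction ι' 𝔭 κ γ Dt'.f ΩK Ωp L ∧
        ‖((PowerSeries.constantCoeff L : unrIntegers 3) : ℂ_[3])‖ =
          ‖((PowerSeries.constantCoeff F : unrIntegers 3) : ℂ_[3])‖ := by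
  have h2 : Module.finrank ℚ K = 2 := hK.1
  have hspl : ((Ideal.span {((3 : ℕ) : ℤ)}).primesOver (𝓞 K)).ncard = 2 :=
    ncard_primesOver_eq_two_of_degreeOne h2 h𝔭 he hf
  have hirrK : (W'.baseChange K).HasIrreducibleModPGaloisRep 3 := irrK_of_surj W' 3 hsurj K h2
  have hd3 : NumberField.discr K ≠ -3 := discr_ne_neg_three_of_degreeOne hK h𝔭 he hf
  obtain ⟨he', hf'⟩ := degreeOne_of_splitsIn (p := 3) h2 hspl h𝔭'
  -- `3 ∤ N′` (good reduction) and the Heegner hypotheses in the shapes the facts want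
  have h3N : ¬ 3 ∣ N' := by
    rw [← hN']
    intro h
    exact ((W'.dvd_conductorNorm_iff_not_hasGoodReductionAtPrime 3).mp h) hss.1
  have hH3 : SatisfiesHeegnerHypothesis 3 K := satisfiesHeegnerHypothesis_three_of_ncard hspl
  have hHN : SatisfiesHeegnerHypothesis (W'.conductorNorm ℤ) K := by rw [hN']; exact hH
  -- the two embeddings
  set e := embAt K 3 𝔭 h𝔭 he hf with hedef
  set e' := embAt K 3 𝔭' h𝔭' he' hf' with he'def
  -- CONTROL at the strict prime `𝔭′` (JSW 3.3.1)
  obtain ⟨-, f₀, hf₀, hf₀0, hval⟩ := h331 W' 3 le_rfl hss.1 K hK hH3 hHN hirrK e' 𝔭'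
    (mem_asIdeal_iff_norm_embAt_lt_one 𝔭' h𝔭' he' hf') κ hκ γ hrk hfin P hP0
  -- VALUE at the frame's prime `𝔭` (CGLS 5.1.3)
  obtain ⟨ΩK, Ωp, L, hΩK, hL, u, hLval⟩ := h513 ι' W' K 𝔭 κ γ Dt' H w e P (by decide) h3N hK hspl
    h𝔭 hι' hH hodd hd3 hκ hγ.out hPH (mem_asIdeal_iff_norm_embAt_lt_one 𝔭 h𝔭 he hf)
  have hΩp : ((Ωp : unrIntegers 3) : ℂ_[3]) ≠ 0 := by
    intro h0
    have h1 := norm_coe_units_unrIntegers 3 Ωp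
    rw [h0, norm_zero] at h1
    exact zero_ne_one h1
  -- the logarithm: non-zero, valuation = padicLogOrd, same along `e` and `e'`
  have hx0 : Castella2018.padicLogOmega W' 3 e P ≠ 0 :=
    Rank1Residual.O5.HeegnerLogTransport.padicLogOmega_ne_zero W' 3 e hP0
  have hxval : (Castella2018.padicLogOmega W' 3 e P).valuation =
      Literature.NumberTheory.EllipticCurves.padicLogOrd W' 3 e P :=
    Castella2018.valuation_padicLogOmega hx0
  have htrans : Literature.NumberTheory.EllipticCurves.padicLogOrd W' 3 e' P =
      Literature.NumberTheory.EllipticCurves.padicLogOrd W' 3 e P := by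
    rw [← padicLogOrd_eq_literature, ← padicLogOrd_eq_literature]
    exact LogSymmetry.padicLogOrd_eq_of_finrank_eq_two W' 3 (by decide) h2 e e' hrk P hP0
  -- assemble
  refine ⟨PowerSeries.map (toUnr 3) f₀, ?_, ?_, ΩK, ((Ωp : unrIntegers 3) : ℂ_[3]), L, hΩK, hΩp, hL, ?_⟩
  · rw [xac_charIdeal_eq_literature, hf₀, map_span_singleton_powerSeries]
  · rw [constantCoeff_map_apply]
    intro h0
    apply hf₀0
    have h1 : ((toUnr 3 (PowerSeries.constantCoeff f₀) : unrIntegers 3) : ℂ_[3]) = 0 := by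
      rw [h0]; rfl
    rw [coe_toUnr] at h1
    have h2' : ((PowerSeries.constantCoeff f₀ : ℤ_[3]) : ℚ_[3]) = 0 :=
      (algebraMap ℚ_[3] ℂ_[3]).injective (by rw [h1, map_zero])
    exact PadicInt.coe_eq_zero.mp h2'
  · refine norm_constantCoeff_eq_of_valueShape hf₀0 u hc (one_sub_add_three_ne_zero_of_dvd hss.2) hx0
      hLval ?_
    rw [hval, htrans, ← hxval, padicValInt_one_sub_add_three_of_dvd hss.2]
    simp only [Nat.cast_zero]
    linarith [hIdx]

/-! ## §3 Child `TwinSplitIMCAtThreeGoodSS` at rank-one instances from named inputs + the index identity -/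

/-- **Crux #3 VERBATIM at a good-supersingular twin of analytic rank one over `K`, from NAMED inputs and the
`3`-part of the Gross–Zagier–BSD index identity.** Same data as `valueFrame_of_goodSS_of_thm331_of_thm513`;
inputs: the OPEN claim `hC` (CÇSS18 Thm. 5.7 + Lemma 5.5, unrefereed: the Howard frame), `h331` (JSW 2017
Thm. 3.3.1), `h513` (CGLS 2022 Thm. 5.1.3), and the scalar `hIdx`. Conclusion: conjuncts (i) ∧ (ii) of
`TwinSplitIMCAtThree` at `(W′, N′, K, Dt′, κ, γ, 𝔭, 𝔭′, ι′)` (`twinSplit_instance_of_howardFrame_of_valueFrame`,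
p547868). On bucket C (603 classes) this leaves child 20695, at every RANK-ONE instance (`P_K` non-torsion —
NOT imposed by the kernel p533077 as it stands; see the module docstring's CAVEAT), resting on the PRE claim
and on BSD₃ of the twin pair in index form — no further research statement.
[cite: CastellaCiperianiSkinnerSprung2018, Thm. 5.7, Lemma 5.5, proof of Thm. 5.8 (arXiv:1804.10993v2 §5.1)]
[cite: JetchevSkinnerWan2017, Thm. 3.3.1 with §3.5 (3.5.d), §7.4.1 (arXiv:1512.06894 pp. 11, 16, 30)]
[cite: CastellaGrossiLeeSkinner2022, Thm. 5.1.3 (Invent. Math. 227)] -/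
theorem twinSplit_instance_of_goodSS_of_ccss_of_thm331_of_thm513
    (hC : CastellaCiperianiSkinnerSprung2018.thm57_lemma55_exists_isBDPLFunction_isTorsion_mem_charIdeal_OPEN)
    (h331 : thm331_anticyclotomicControl) (h513 : thm513_exists_isBDPLFunction_valueAtOne_disc)
    (hss : GoodSS W' 3) (hsurj : W'.HasSurjectiveModNGaloisRep 3) (hN' : W'.conductorNorm ℤ = N')
    (hc : Dt'.c ≠ 0)
    (hK : IsImaginaryQuadratic K) (hH : SatisfiesHeegnerHypothesis N' K)
    (hodd : Odd (NumberField.discr K)) (hκ : κ.IsAnticyclotomic) [hγ : Fact (κ.IsTopGenerator γ)]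
    (h𝔭 : ((3 : ℕ) : 𝓞 K) ∈ 𝔭.asIdeal)
    (he : 𝔭.asIdeal.ramificationIdx (𝓞 ℚ) = 1) (hf : 𝔭.asIdeal.inertiaDeg (𝓞 ℚ) = 1)
    (h𝔭' : ((3 : ℕ) : 𝓞 K) ∈ 𝔭'.asIdeal) (hne : 𝔭' ≠ 𝔭)
    (hι' : BranchInducesPrime 3 ι' 𝔭)
    (H : HeegnerDatum N' (NumberField.discr K)) (w : InfinitePlace K)
    (P : (W'.baseChange K).toAffine.Point)
    (hPH : WeierstrassCurve.Affine.Point.map w.embedding.toRatAlgHom P = heegnerPointComplex Dt' H)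
    (hP0 : ¬ IsOfFinAddOrder P)
    (hrk : (W'.baseChange K).mordellWeilRank = 1)
    (hfin : Finite (AddCommGroup.primaryComponent (W'.baseChange K).sha 3))
    (hIdx : 2 * (padicValNat 3 (AddSubgroup.zmultiples P).index : ℤ) =
      (padicValNat 3 (Nat.card (AddCommGroup.primaryComponent (W'.baseChange K).sha 3)) : ℤ) +
        (padicValNat 3 (W'.baseChange K).tamagawaProduct : ℤ) + 2 * padicValInt 3 Dt'.c) :
    (∃ (ΩK : ℂ) (Ωp : ℂ_[3]) (L' : UnrSeries 3), ΩK ≠ 0 ∧ Ωp ≠ 0 ∧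
        IsBDPLFunction ι' 𝔭 κ γ Dt'.f ΩK Ωp L') ∧
      (∀ (ΩK : ℂ) (Ωp : ℂ_[3]) (L' : UnrSeries 3), ΩK ≠ 0 → Ωp ≠ 0 →
        IsBDPLFunction ι' 𝔭 κ γ Dt'.f ΩK Ωp L' →
        (AcSelmer.XAc.charIdeal (W'.baseChange K) 3 κ 𝔭' ∅ γ).map (PowerSeries.map (toUnr 3)) =
          Ideal.span {L'}) := by
  obtain ⟨F, hCh, hF0, hVal⟩ := valueFrame_of_goodSS_of_thm331_of_thm513 W' N' K Dt' κ γ 𝔭 𝔭' ι' h331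
    h513 hss hsurj hN' hc hK hH hodd hκ h𝔭 he hf h𝔭' hι' H w P hPH hP0 hrk hfin hIdx
  obtain ⟨-, hHow⟩ := exists_howardFrame_isTorsion_of_goodSS_of_ccss hC W' N' K Dt' hss hsurj hK hH κ
    hκ γ 𝔭 h𝔭 he hf 𝔭' h𝔭' hne ι' hι'
  exact twinSplit_instance_of_howardFrame_of_valueFrame W' N' K Dt' κ γ 𝔭 𝔭' ι' hK hκ hCh hF0 hHow hVal

end Three

end Summit.BirchSwinnertonDyer.BirchSwinnertonDyer.Theorems.UniversalToricDescentTwinSplit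

end
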